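import Summits.CriticalPhenomena.CardyFormulaZ2.Theorems.CardySelfRefinementLagHandOffExplorationSuffix
import Summits.CriticalPhenomena.CardyFormulaZ2.Theorems.CardySusyWardDiscretisationFamilyExistsSidesB
import HarnessLib

/-!
# Exact lattice target independence at one mesh: helper for stub `stub_discreteSplitting` of line
`hitting-tournament` for crux `LagHandOff` (stmt-CriticalPhenomena-10268)

Deterministic part, one mesh.  Two admissible Dobrushin data `E₁ = ⟨Ω, δ, A₁, B₁⟩` (for the chord
`(x₀, x₁)` of a `3`-marked domain) and `E₂ = ⟨Ω, δ, A₂, B₂⟩` (for the chord `(x₀, x₂)`) with NESTED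
discrete arcs `A(E₁) ⊆ A(E₂)`, `B(E₂) ⊆ B(E₁)`, a COMMON `A`–`B` edge `e_a` near `x₀`
(`zdABEdges E₂ = {e_a, e_b}`, `zdABEdges E₁ = {e_a, e₁}`, `e_b` near `x₂`, `e₁` near `x₁`) and the
relabelled sites `A(E₂) ∖ A(E₁)` all `ρ'`-close to the arc `[x₁, x₂]`: for EVERY configuration the
two interfaces coincide or share a parametrised prefix ending `(ρ' + 3δ/2)`-close to `[x₁, x₂]`.
The two completed configurations agree at every site none of whose neighbours is relabelled, the
start corner at `e_a` (negatively oriented loop) or the end corner at `e_a` (positively oriented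
loop) is common to both data, and the landed prefix / suffix theorems
(`bondInterfaceIn_eq_or_commonPrefix`, `…_rev`) apply.
-/

noncomputable section

open MeasureTheory Filter Set Topology
open scoped unitInterval BoundedContinuousFunction
open Literature.Probability.Percolation Literature.Probability.LatticeModels
open Literature.Probability.RandomPlanarGeometry Literature.Probability.Percolation.QuadCrossing
open Summit.CriticalPhenomena.CardyFormulaZ2.Cruxes.LagHandOff.CrosscutDictionary
open Summit.CriticalPhenomena.CardyFormulaZ2.Theorems

namespace Summit.CriticalPhenomena.CardyFormulaZ2.Cruxes.LagHandOff.HittingTournament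

/-- Lattice neighbours are one mesh apart. -/
theorem dist_meshPoint_add_cornerUnit' {δ : ℝ} (hδ : 0 ≤ δ) (v : Site 2) (k : Fin 4) :
    dist (meshPoint δ v) (meshPoint δ (v + cornerUnit k)) = δ := by
  rw [dist_comm, dist_eq_norm, DiscretisationFamilyExists.meshPoint_add, add_sub_cancel_left,
    DiscretisationFamilyExists.norm_meshPoint_cornerUnit, abs_of_nonneg hδ]

/-- **Target independence at one mesh (deterministic).** See the module docstring. -/
theorem splitting_at_mesh (D : MarkedDomain 3) {Ω : Set ℂ} {δ : ℝ} (hδ : 0 ≤ δ)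
    {A₁ B₁ A₂ B₂ : Set ℂ}
    (hE₁ : (⟨Ω, δ, A₁, B₁⟩ : DiscreteDobrushin).IsZdAdmissible)
    (hE₂ : (⟨Ω, δ, A₂, B₂⟩ : DiscreteDobrushin).IsZdAdmissible)
    (hA : (⟨Ω, δ, A₁, B₁⟩ : DiscreteDobrushin).zdArcA ⊆ (⟨Ω, δ, A₂, B₂⟩ : DiscreteDobrushin).zdArcA)
    (hB : (⟨Ω, δ, A₂, B₂⟩ : DiscreteDobrushin).zdArcB ⊆ (⟨Ω, δ, A₁, B₁⟩ : DiscreteDobrushin).zdArcB)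
    {ea eb e1 : Sym2 (Site 2)}
    (h2 : (⟨Ω, δ, A₂, B₂⟩ : DiscreteDobrushin).zdABEdges = {ea, eb})
    (h1 : (⟨Ω, δ, A₁, B₁⟩ : DiscreteDobrushin).zdABEdges = {ea, e1})
    (hoa1 : dist (medialPoint δ ea) (D.pt 0) ≤ dist (medialPoint δ ea) (D.pt 1))
    (hoa2 : dist (medialPoint δ ea) (D.pt 0) ≤ dist (medialPoint δ ea) (D.pt 2))
    (hob : dist (medialPoint δ eb) (D.pt 2) < dist (medialPoint δ eb) (D.pt 0))
    (ho1 : dist (medialPoint δ e1) (D.pt 1) < dist (medialPoint δ e1) (D.pt 0))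
    {ρ' : ℝ}
    (hΔ : ∀ y ∈ (⟨Ω, δ, A₂, B₂⟩ : DiscreteDobrushin).zdArcA,
      y ∉ (⟨Ω, δ, A₁, B₁⟩ : DiscreteDobrushin).zdArcA → Metric.infDist (meshPoint δ y) (D.arc 1) ≤ ρ')
    (ω : BondConfig (Site 2)) :
    bondInterfaceIn (D.chord 0 1 (by decide)) ⟨Ω, δ, A₁, B₁⟩ ω =
        bondInterfaceIn (D.chord 0 2 (by decide)) ⟨Ω, δ, A₂, B₂⟩ ω ∨
      ∃ (c c' : Curve ℂ) (s : unitInterval),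
        CurveClass.mk c = bondInterfaceIn (D.chord 0 1 (by decide)) ⟨Ω, δ, A₁, B₁⟩ ω ∧
        CurveClass.mk c' = bondInterfaceIn (D.chord 0 2 (by decide)) ⟨Ω, δ, A₂, B₂⟩ ω ∧
        (∀ t : unitInterval, t ≤ s → c t = c' t) ∧
        c s ∈ Metric.cthickening (ρ' + 3 * δ / 2) (D.arc 1) := by
  set E₁ : DiscreteDobrushin := ⟨Ω, δ, A₁, B₁⟩ with hE₁d
  set E₂ : DiscreteDobrushin := ⟨Ω, δ, A₂, B₂⟩ with hE₂d
  set D₁ : DobrushinDomain := D.chord 0 1 (by decide) with hD₁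
  set D₂ : DobrushinDomain := D.chord 0 2 (by decide) with hD₂
  -- the relabelled sites and the compatible region
  set Δ : Set (Site 2) := {y | y ∈ E₂.zdArcA ∧ y ∉ E₁.zdArcA} with hΔd
  set U : Set (Site 2) := {v | v ∉ Δ ∧ ∀ k, v + cornerUnit k ∉ Δ} with hUd
  have hbd : E₁.zdBoundary = E₂.zdBoundary := rfl
  have hinner : ∀ f, E₁.IsInnerFace f ↔ E₂.IsInnerFace f := fun f => Iff.rfl
  -- sites off `Δ` carry the same labels in both data
  have hlabA : ∀ x, x ∉ Δ → (x ∈ E₁.zdArcA ↔ x ∈ E₂.zdArcA) := fun x hx =>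
    ⟨fun h => hA h, fun h => by_contra fun h' => hx ⟨h, h'⟩⟩
  have hlabB : ∀ x, x ∉ Δ → (x ∈ E₁.zdArcB ↔ x ∈ E₂.zdArcB) := by
    intro x hx
    refine ⟨fun h => ?_, fun h => hB h⟩
    have hxb : x ∈ E₂.zdBoundary := hbd ▸ E₁.zdArcB_subset_zdBoundary h
    rcases hE₂.zdBoundary_subset hxb with h2 | h2
    · exact absurd ((hlabA x hx).2 h2) fun h1 => Set.disjoint_left.1 hE₁.disjoint h1 h
    · exact h2
  have hU : ∀ p : Site 2 × Fin 4, p.1 ∈ U →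
      ((cTgt p ∈ E₁.bcBondConfig ω ↔ cTgt p ∈ E₂.bcBondConfig ω) ∧
        (E₁.IsInnerFace (cFace p) ↔ E₂.IsInnerFace (cFace p))) := by
    rintro p ⟨hp0, hpk⟩
    refine ⟨?_, hinner _⟩
    simp only [DiscreteDobrushin.mem_bcBondConfig_iff, cTgt, DiscretisationFamilyExists.forall_mem_sym2_iff]
    rw [hlabA _ hp0, hlabA _ (hpk _), hlabB _ hp0, hlabB _ (hpk _)]
  -- the end point of a common prefix ending at a corner off `U` is close to the arc `[x₁, x₂]`
  have harc1 : (D.arc 1).Nonempty := ⟨_, D.pt_mem_arc_self 1⟩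
  have hclose : ∀ p : Site 2 × Fin 4, p.1 ∉ U →
      medialPoint δ (cSrc p) ∈ Metric.cthickening (ρ' + 3 * δ / 2) (D.arc 1) := by
    intro p hp
    have hw : ∃ w ∈ Δ, dist (meshPoint δ p.1) (meshPoint δ w) ≤ δ := by
      by_cases h0 : p.1 ∈ Δ
      · exact ⟨p.1, h0, by rw [dist_self]; exact hδ⟩
      · have : ¬ ∀ k, p.1 + cornerUnit k ∉ Δ := fun h => hp ⟨h0, h⟩
        push Not at this
        obtain ⟨k, hk⟩ := this
        refine ⟨_, hk, ?_⟩
        exact (dist_meshPoint_add_cornerUnit' hδ _ _).le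
    obtain ⟨w, hwΔ, hw⟩ := hw
    obtain ⟨z, hz, hzd⟩ := (D.isCompact_arc 1).exists_infDist_eq_dist harc1 (meshPoint δ w)
    have h1 : Metric.infDist (meshPoint δ w) (D.arc 1) ≤ ρ' := hΔ w hwΔ.1 hwΔ.2
    have h2 : dist (medialPoint δ (cSrc p)) (meshPoint δ p.1) ≤ δ / 2 := by
      rw [medialPoint_cSrc, dist_eq_norm, add_sub_cancel_left, norm_div, norm_mul, norm_pow, Complex.norm_I,
        one_pow, mul_one, Complex.norm_real, Real.norm_eq_abs, abs_of_nonneg hδ, Complex.norm_two]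
    refine Metric.mem_cthickening_of_dist_le _ z _ _ hz ?_
    calc dist (medialPoint δ (cSrc p)) z
        ≤ dist (medialPoint δ (cSrc p)) (meshPoint δ p.1) + dist (meshPoint δ p.1) (meshPoint δ w) +
            dist (meshPoint δ w) z := dist_triangle4 _ _ _ _
      _ ≤ δ / 2 + δ + ρ' := by rw [← hzd]; linarith
      _ = ρ' + 3 * δ / 2 := by ring
  -- an `A`-end (in `E₂`) of the common edge `e_a` is an `A`-end in `E₁`
  have hea1 : ea ∈ E₁.zdABEdges := by rw [h1]; exact Or.inl rfl
  have hea2 : ea ∈ E₂.zdABEdges := by rw [h2]; exact Or.inl rfl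
  have htransfer : ∀ (x : Site 2) (k : Fin 4), s(x, x + cornerUnit k) = ea → x ∈ E₂.zdArcA →
      x + cornerUnit k ∈ E₂.zdArcB → x ∈ E₁.zdArcA ∧ x + cornerUnit k ∈ E₁.zdArcB := by
    intro x k hxk hxA hxB
    refine ⟨?_, hB hxB⟩
    obtain ⟨-, ⟨y, hy, hyA⟩, -⟩ := hea1
    rw [← hxk] at hy
    rcases Sym2.mem_iff.1 hy with rfl | rfl
    · exact hyA
    · exact absurd hyA fun h => Set.disjoint_left.1 hE₁.disjoint h (hB hxB)
  -- the start corner of `E₂`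
  obtain ⟨c₂, ⟨hc₂A, hc₂B, hc₂O⟩, -⟩ := DiscreteDobrushin.existsUnique_startCorner hE₂
  have hc₂ : E₂.IsStartCorner c₂ := ⟨hc₂A, hc₂B, hc₂O⟩
  have hsrc₂ : cSrc c₂ ∈ E₂.zdABEdges :=
    DiscreteDobrushin.cSrc_mem_zdABEdges hc₂A hc₂B (Or.inl hc₂O)
  have hfinish : ∀ {c c' : Curve ℂ} {s : unitInterval} {p : Site 2 × Fin 4},
      CurveClass.mk c = bondInterfaceIn D₁ E₁ ω → CurveClass.mk c' = bondInterfaceIn D₂ E₂ ω →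
      (∀ t : unitInterval, t ≤ s → c t = c' t) → c s = medialPoint E₁.δ (cSrc p) → p.1 ∉ U →
      bondInterfaceIn D₁ E₁ ω = bondInterfaceIn D₂ E₂ ω ∨
        ∃ (c c' : Curve ℂ) (s : unitInterval), CurveClass.mk c = bondInterfaceIn D₁ E₁ ω ∧
          CurveClass.mk c' = bondInterfaceIn D₂ E₂ ω ∧ (∀ t : unitInterval, t ≤ s → c t = c' t) ∧
          c s ∈ Metric.cthickening (ρ' + 3 * δ / 2) (D.arc 1) :=
    fun h1 h2 h3 h4 h5 => Or.inr ⟨_, _, _, h1, h2, h3, h4 ▸ hclose _ h5⟩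
  rw [h2] at hsrc₂
  rcases hsrc₂ with hsa | hsb
  · -- the exploration of `E₂` starts at `e_a`: so does that of `E₁`, with the same corner
    obtain ⟨h1A, h1B⟩ := htransfer c₂.1 c₂.2 hsa hc₂A hc₂B
    have hc₁ : E₁.IsStartCorner c₂ := ⟨h1A, h1B, hc₂O⟩
    have ho₁ : dist (medialPoint E₁.δ (cSrc c₂)) (D₁.pt 0) ≤ dist (medialPoint E₁.δ (cSrc c₂)) (D₁.pt 1) := by
      show dist (medialPoint δ (cSrc c₂)) (D.pt 0) ≤ dist (medialPoint δ (cSrc c₂)) (D.pt 1)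
      rw [hsa]; exact hoa1
    have ho₂ : dist (medialPoint E₂.δ (cSrc c₂)) (D₂.pt 0) ≤ dist (medialPoint E₂.δ (cSrc c₂)) (D₂.pt 1) := by
      show dist (medialPoint δ (cSrc c₂)) (D.pt 0) ≤ dist (medialPoint δ (cSrc c₂)) (D.pt 2)
      rw [hsa]; exact hoa2
    rcases bondInterfaceIn_eq_or_commonPrefix D₁ D₂ hE₁ hE₂ rfl hc₁ hc₂ ho₁ ho₂ U (ω₁ := ω) (ω₂ := ω) hU
      with h | ⟨c, c', s, p, h1, h2, h3, h4, h5⟩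
    · exact Or.inl h
    · exact hfinish h1 h2 h3 h4 h5
  · -- the exploration of `E₂` starts at `e_b` and ends at `e_a`: common end corner
    obtain ⟨N, hN, hlt, -⟩ := exists_medialExploration_eq_explorationList hE₂ hc₂ ω
    obtain ⟨M, rfl⟩ : ∃ M, N = M + 1 :=
      Nat.exists_eq_succ_of_ne_zero (by rintro rfl; exact hN hc₂O.1)
    have hin : E₂.IsInnerFace (cFace (cornerOrbit (E₂.bcBondConfig ω) c₂ M)) := hlt M (Nat.lt_succ_self _)
    set cb := cornerOrbit (E₂.bcBondConfig ω) c₂ M with hcb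
    obtain ⟨-, hbA, hbB, hbIn⟩ := cornerOrbit_exit hE₂ hc₂ hin hN
    have hbmem := cTgt_exit_mem_zdABEdges hE₂ hc₂ hin hN
    have hbne := cTgt_exit_ne_cSrc_start hE₂ hc₂ hin hN
    have htgt : cTgt cb = ea := by
      rw [h2] at hbmem
      rcases hbmem with h | h
      · exact h
      · exact absurd (h.trans hsb.symm) hbne
    obtain ⟨hbA₁, hbB₁⟩ := htransfer cb.1 (cb.2 + 1) htgt hbA hbB
    have hbIn₁ : E₁.IsInEdge cb.1 (cb.2 + 1) := hbIn
    -- the start corner of `E₁` is at `e₁`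
    obtain ⟨c₁, ⟨hc₁A, hc₁B, hc₁O⟩, -⟩ := DiscreteDobrushin.existsUnique_startCorner hE₁
    have hc₁ : E₁.IsStartCorner c₁ := ⟨hc₁A, hc₁B, hc₁O⟩
    have hsrc₁ : cSrc c₁ ∈ E₁.zdABEdges :=
      DiscreteDobrushin.cSrc_mem_zdABEdges hc₁A hc₁B (Or.inl hc₁O)
    have hsrc₁' : cSrc c₁ = e1 := by
      rw [h1] at hsrc₁
      rcases hsrc₁ with h | h
      · exfalso
        have := DiscreteDobrushin.eq_of_cSrc_eq_of_arcs hE₁ (p := (cb.1, cb.2 + 1)) (q := c₁) hbA₁ hc₁B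
          (by show cTgt cb = cSrc c₁; rw [htgt, h])
        rw [← this] at hc₁O
        exact hc₁O.not_isInEdge hbIn₁
      · exact h
    have ho₁ : dist (medialPoint E₁.δ (cSrc c₁)) (D₁.pt 1) < dist (medialPoint E₁.δ (cSrc c₁)) (D₁.pt 0) := by
      show dist (medialPoint δ (cSrc c₁)) (D.pt 1) < dist (medialPoint δ (cSrc c₁)) (D.pt 0)
      rw [hsrc₁']; exact ho1
    have ho₂ : dist (medialPoint E₂.δ (cSrc c₂)) (D₂.pt 1) < dist (medialPoint E₂.δ (cSrc c₂)) (D₂.pt 0) := by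
      show dist (medialPoint δ (cSrc c₂)) (D.pt 2) < dist (medialPoint δ (cSrc c₂)) (D.pt 0)
      rw [hsb]; exact hob
    rcases bondInterfaceIn_eq_or_commonPrefix_rev D₁ D₂ hE₁ hE₂ rfl hc₁ hc₂ hbA₁ hbB₁ hbIn₁ hbA hbB hbIn
      ho₁ ho₂ U (ω₁ := ω) (ω₂ := ω) hU with h | ⟨c, c', s, p, h1, h2, h3, h4, h5⟩
    · exact Or.inl h
    · exact hfinish h1 h2 h3 h4 h5

/-! ### Registered sub-goal (one-line signature, verbatim) -/

/-- **Registered sub-goal `stub_discreteSplitting_atMesh` of `stub_discreteSplitting`**: the one-mesh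
deterministic target independence `splitting_at_mesh`, fully quantified. -/
theorem stub_discreteSplitting_atMesh : ∀ (D : MarkedDomain 3) (Ω : Set ℂ) (δ : ℝ), 0 ≤ δ → ∀ (A₁ B₁ A₂ B₂ : Set ℂ), (⟨Ω, δ, A₁, B₁⟩ : DiscreteDobrushin).IsZdAdmissible → (⟨Ω, δ, A₂, B₂⟩ : DiscreteDobrushin).IsZdAdmissible → (⟨Ω, δ, A₁, B₁⟩ : DiscreteDobrushin).zdArcA ⊆ (⟨Ω, δ, A₂, B₂⟩ : DiscreteDobrushin).zdArcA → (⟨Ω, δ, A₂, B₂⟩ : DiscreteDobrushin).zdArcB ⊆ (⟨Ω, δ, A₁, B₁⟩ : DiscreteDobrushin).zdArcB → ∀ (ea eb e1 : Sym2 (Site 2)), (⟨Ω, δ, A₂, B₂⟩ : DiscreteDobrushin).zdABEdges = {ea, eb} → (⟨Ω, δ, A₁, B₁⟩ : DiscreteDobrushin).zdABEdges = {ea, e1} → dist (medialPoint δ ea) (D.pt 0) ≤ dist (medialPoint δ ea) (D.pt 1) → dist (medialPoint δ ea) (D.pt 0) ≤ dist (medialPoint δ ea) (D.pt 2) → dist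 (medialPoint δ eb) (D.pt 2) < dist (medialPoint δ eb) (D.pt 0) → dist (medialPoint δ e1) (D.pt 1) < dist (medialPoint δ e1) (D.pt 0) → ∀ ρ' : ℝ, (∀ y ∈ (⟨Ω, δ, A₂, B₂⟩ : DiscreteDobrushin).zdArcA, y ∉ (⟨Ω, δ, A₁, B₁⟩ : DiscreteDobrushin).zdArcA → Metric.infDist (meshPoint δ y) (D.arc 1) ≤ ρ') → ∀ ω : BondConfig (Site 2), bondInterfaceIn (D.chord 0 1 (by decide)) ⟨Ω, δ, A₁, B₁⟩ ω = bondInterfaceIn (D.chord 0 2 (by decide)) ⟨Ω, δ, A₂, B₂⟩ ω ∨ ∃ (c c' : Curve ℂ) (s : unitInterval), CurveClass.mk c = bondInterfaceIn (D.chord 0 1 (by decide)) ⟨Ω, δ, A₁, B₁⟩ ω ∧ CurveClass.mk c' = bondInterfaceIn (D.chord 0 2 (by decide)) ⟨Ω, δ, A₂, B₂⟩ ω ∧ (∀ t : unitInterval, t ≤ s → c t = c' t) ∧ c s ∈ Metric.cthickening (ρ' + 3 * δ / 2) (D.arc 1) :=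
  fun D _ _ hδ _ _ _ _ hE₁ hE₂ hA hB _ _ _ h2 h1 hoa1 hoa2 hob ho1 _ hΔ ω =>
    splitting_at_mesh D hδ hE₁ hE₂ hA hB h2 h1 hoa1 hoa2 hob ho1 hΔ ω

end Summit.CriticalPhenomena.CardyFormulaZ2.Cruxes.LagHandOff.HittingTournament

end
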